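import Mathlib.Data.Nat.Bitwise
import Mathlib.Tactic.IntervalCases
import HarnessLib

/-!
# A kernel-evaluable 4-colouring search on bit-vector states (unit propagation + PASS branching) — machinery and soundness
Framing (verbatim for the cell): lottery ticket; floor = certified bounds/negative ranges.
Search state for a `4`-colouring of a graph on the vertices `0 … n−1`: five natural numbers `C₀ C₁ C₂ C₃ U` read as bit-sets
of vertices — `v ∈ C_c` iff colour `c` is still available at `v`, `v ∈ U` iff `v` is uncoloured.  The neighbourhood of `v` is a
bit-set `nb v` supplied by the instance.  Everything is `Nat` bit arithmetic (`land/lor/xor/shiftRight/testBit/sub`), evaluated by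
the kernel with GMP: colouring `v` with `c` is `C_c ← C_c ∖ nb v`, the forced vertices (exactly one available colour) and the dead
ones (none) are Boolean combinations of the five words, a vertex is extracted as the lowest set bit.  `search` answers `true` only
if every branch dies; `search_sound` turns that into "no proper colouring is consistent with the state".  The branching rule
(fewest available colours, PASS tie-break over the lowest 8 candidates) and the bit-index routine are heuristics: soundness does
not depend on them.  Instance: `FiniteFieldLowerBoundF19.lean` (`UD(F₁₉²)` is not 4-colourable).
-/

namespace Summit.Ventures.DiscreteObjects.UnitDistance.KBits
/-- Select the colour word. -/
def getC (C₀ C₁ C₂ C₃ c : ℕ) : ℕ := if c = 0 then C₀ else if c = 1 then C₁ else if c = 2 then C₂ else C₃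
/-- `testBit` of the raw `Nat.xor` (the search uses the raw operations, the library lemmas the `^^^` notation). -/
theorem testBit_natXor (x y i : ℕ) : (Nat.xor x y).testBit i = (x.testBit i ^^ y.testBit i) := Nat.testBit_xor x y i
/-- `testBit` of the raw `Nat.land`. -/
theorem testBit_natLand (x y i : ℕ) : (Nat.land x y).testBit i = (x.testBit i && y.testBit i) := Nat.testBit_land x y i
/-- Lowest set bit of `x` (as a power of two; `0 ↦ 0`). -/
def lowbit (x : ℕ) : ℕ := Nat.xor x (Nat.land x (x - 1))
/-- One step of the binary search for the bit index. -/
def bitStep (b k acc : ℕ) : ℕ := if Nat.ble (2 ^ (acc + k)) b then acc + k else acc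
/-- Index of a one-hot word `b = 2^v` with `v < 512` by binary search (heuristic: soundness never relies on it). -/
def bitIdx (b : ℕ) : ℕ :=
  bitStep b 1 (bitStep b 2 (bitStep b 4 (bitStep b 8 (bitStep b 16 (bitStep b 32 (bitStep b 64 (bitStep b 128
    (bitStep b 256 0))))))))
/-- Popcount by clearing lowest bits (`fuel` bounds the number of set bits counted). -/
def popcnt : ℕ → ℕ → ℕ
  | 0, _ => 0
  | f + 1, x => if x = 0 then 0 else popcnt f (Nat.land x (x - 1)) + 1
/-- The four availability bits of vertex `v`. -/
def bits4 (C₀ C₁ C₂ C₃ v : ℕ) : Bool × Bool × Bool × Bool :=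
  (Nat.testBit C₀ v, Nat.testBit C₁ v, Nat.testBit C₂ v, Nat.testBit C₃ v)
/-- From the four availability bits: `some c` iff exactly one colour `c` is available. -/
def forcedOf : Bool × Bool × Bool × Bool → Option ℕ
  | (true, false, false, false) => some 0
  | (false, true, false, false) => some 1
  | (false, false, true, false) => some 2
  | (false, false, false, true) => some 3
  | _ => none
/-- From the four availability bits: no colour available. -/
def deadOf : Bool × Bool × Bool × Bool → Bool
  | (false, false, false, false) => true
  | _ => false
/-- Dead set `W = U ∖ (C₀ ∪ C₁ ∪ C₂ ∪ C₃)` and forced set `E₁ = {v ∈ U : exactly one colour available}`. -/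
def deadForced (C₀ C₁ C₂ C₃ U : ℕ) : ℕ × ℕ :=
  let al1 := Nat.lor (Nat.lor C₀ C₁) (Nat.lor C₂ C₃)
  let x1 := Nat.xor (Nat.xor C₀ C₁) (Nat.xor C₂ C₃)
  let al2 := Nat.lor (Nat.lor (Nat.lor (Nat.land C₀ C₁) (Nat.land C₀ C₂)) (Nat.lor (Nat.land C₀ C₃) (Nat.land C₁ C₂)))
    (Nat.lor (Nat.land C₁ C₃) (Nat.land C₂ C₃))
  let ux := Nat.land U x1
  (Nat.xor U (Nat.land U al1), Nat.xor ux (Nat.land ux al2))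
/-- Candidate classes `E₂, E₃, E₄` (uncoloured vertices with exactly 2 / 3 / 4 available colours). -/
def classes (C₀ C₁ C₂ C₃ U : ℕ) : ℕ × ℕ × ℕ :=
  let al2 := Nat.lor (Nat.lor (Nat.lor (Nat.land C₀ C₁) (Nat.land C₀ C₂)) (Nat.lor (Nat.land C₀ C₃) (Nat.land C₁ C₂)))
    (Nat.lor (Nat.land C₁ C₃) (Nat.land C₂ C₃))
  let al3 := Nat.lor (Nat.lor (Nat.land (Nat.land C₀ C₁) C₂) (Nat.land (Nat.land C₀ C₁) C₃))
    (Nat.lor (Nat.land (Nat.land C₀ C₂) C₃) (Nat.land (Nat.land C₁ C₂) C₃))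
  let al4 := Nat.land (Nat.land C₀ C₁) (Nat.land C₂ C₃)
  let u2 := Nat.land U al2
  let u3 := Nat.land U al3
  (Nat.xor u2 (Nat.land u2 al3), Nat.xor u3 (Nat.land u3 al4), Nat.land U al4)
/-- Colour `v` with `c`: remove `v` from `U` and colour `c` from the neighbours of `v`.  Returns the new `(C₀, C₁, C₂, C₃, U)`. -/
def assign (nb : ℕ → ℕ) (C₀ C₁ C₂ C₃ U v c : ℕ) : ℕ × ℕ × ℕ × ℕ × ℕ :=
  if c = 0 then (Nat.xor C₀ (Nat.land C₀ (nb v)), C₁, C₂, C₃, Nat.xor U (2 ^ v))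
  else if c = 1 then (C₀, Nat.xor C₁ (Nat.land C₁ (nb v)), C₂, C₃, Nat.xor U (2 ^ v))
  else if c = 2 then (C₀, C₁, Nat.xor C₂ (Nat.land C₂ (nb v)), C₃, Nat.xor U (2 ^ v))
  else (C₀, C₁, C₂, Nat.xor C₃ (Nat.land C₃ (nb v)), Nat.xor U (2 ^ v))
/-- Process a snapshot `F` of forced vertices one by one (lowest bit first): re-read the four bits, die on an empty mask,
assign the unique colour otherwise.  `none` = the branch is dead. -/
def forceList (nb : ℕ → ℕ) : ℕ → ℕ → ℕ × ℕ × ℕ × ℕ × ℕ → Option (ℕ × ℕ × ℕ × ℕ × ℕ)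
  | 0, _, st => some st
  | f + 1, F, (C₀, C₁, C₂, C₃, U) =>
      if F = 0 then some (C₀, C₁, C₂, C₃, U)
      else
        if Nat.testBit U (bitIdx (lowbit F)) then
          if deadOf (bits4 C₀ C₁ C₂ C₃ (bitIdx (lowbit F))) then none
          else
            match forcedOf (bits4 C₀ C₁ C₂ C₃ (bitIdx (lowbit F))) with
            | some c => forceList nb f (Nat.xor F (lowbit F)) (assign nb C₀ C₁ C₂ C₃ U (bitIdx (lowbit F)) c)
            | none => forceList nb f (Nat.xor F (lowbit F)) (C₀, C₁, C₂, C₃, U)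
        else forceList nb f (Nat.xor F (lowbit F)) (C₀, C₁, C₂, C₃, U)
/-- Unit propagation to closure (`r` rounds at most): a non-empty dead set kills the branch. -/
def propagate (nb : ℕ → ℕ) : ℕ → ℕ × ℕ × ℕ × ℕ × ℕ → Option (ℕ × ℕ × ℕ × ℕ × ℕ)
  | 0, st => some st
  | r + 1, (C₀, C₁, C₂, C₃, U) =>
      if (deadForced C₀ C₁ C₂ C₃ U).1 = 0 then
        if (deadForced C₀ C₁ C₂ C₃ U).2 = 0 then some (C₀, C₁, C₂, C₃, U)
        else
          match forceList nb 400 (deadForced C₀ C₁ C₂ C₃ U).2 (C₀, C₁, C₂, C₃, U) with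
          | none => none
          | some st' => propagate nb r st'
      else
        if Nat.testBit U (bitIdx (lowbit (deadForced C₀ C₁ C₂ C₃ U).1)) &&
            deadOf (bits4 C₀ C₁ C₂ C₃ (bitIdx (lowbit (deadForced C₀ C₁ C₂ C₃ U).1))) then none
        else some (C₀, C₁, C₂, C₃, U)
/-- PASS score of candidate `v` within the class `E`: over the available colours `c` of `v`, the number of neighbours in `E ∩ C_c`. -/
def score (nb : ℕ → ℕ) (C₀ C₁ C₂ C₃ E v : ℕ) : ℕ :=
  let N := Nat.land (nb v) E
  (if Nat.testBit C₀ v then popcnt 24 (Nat.land N C₀) else 0) + (if Nat.testBit C₁ v then popcnt 24 (Nat.land N C₁) else 0) +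
    (if Nat.testBit C₂ v then popcnt 24 (Nat.land N C₂) else 0) + (if Nat.testBit C₃ v then popcnt 24 (Nat.land N C₃) else 0)
/-- Best of the lowest `f` candidates of `F` (largest score, lowest index on ties); accumulator `(best, bestScore + 1)`. -/
def pickBest (nb : ℕ → ℕ) (C₀ C₁ C₂ C₃ E : ℕ) : ℕ → ℕ → ℕ × ℕ → ℕ × ℕ
  | 0, _, acc => acc
  | f + 1, F, acc =>
      if F = 0 then acc
      else
        let v := bitIdx (lowbit F)
        let sc := score nb C₀ C₁ C₂ C₃ E v + 1
        pickBest nb C₀ C₁ C₂ C₃ E f (Nat.xor F (lowbit F)) (if acc.2 < sc then (v, sc) else acc)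
/-- The branching vertex: a member of the smallest non-empty class `E₂, E₃, E₄`, chosen by PASS among its lowest 8 members. -/
def branchVertex (nb : ℕ → ℕ) (C₀ C₁ C₂ C₃ U : ℕ) : ℕ :=
  let cl := classes C₀ C₁ C₂ C₃ U
  let E := if cl.1 = 0 then (if cl.2.1 = 0 then cl.2.2 else cl.2.1) else cl.1
  (pickBest nb C₀ C₁ C₂ C₃ E 8 E (0, 0)).1
/-- THE SEARCH (`n` vertices, propagation bound `pr` rounds, `done` = states already refuted elsewhere):
`true` = every branch below the state dies. -/
def search (nb : ℕ → ℕ) (n pr : ℕ) (done : List (ℕ × ℕ × ℕ × ℕ × ℕ)) : ℕ → ℕ × ℕ × ℕ × ℕ × ℕ → Bool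
  | 0, _ => false
  | f + 1, (C₀, C₁, C₂, C₃, U) =>
      if done.any fun d => decide (d = (C₀, C₁, C₂, C₃, U)) then true
      else if U = 0 then false
      else
        if branchVertex nb C₀ C₁ C₂ C₃ U < n && Nat.testBit U (branchVertex nb C₀ C₁ C₂ C₃ U) then
          [0, 1, 2, 3].all fun c =>
            !Nat.testBit (getC C₀ C₁ C₂ C₃ c) (branchVertex nb C₀ C₁ C₂ C₃ U) ||
              (match propagate nb pr (assign nb C₀ C₁ C₂ C₃ U (branchVertex nb C₀ C₁ C₂ C₃ U) c) with
               | none => true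
               | some st' => search nb n pr done f st')
        else false

/-! ## Soundness -/

/-- `col` is a proper `4`-colouring of the vertices `< n` for the neighbourhood bit-sets `nb`. -/
def Proper (nb : ℕ → ℕ) (n : ℕ) (col : ℕ → ℕ) : Prop :=
  ∀ v, v < n → col v < 4 ∧ ∀ w, w < n → Nat.testBit (nb v) w = true → col w ≠ col v
/-- `col` is consistent with the state: every uncoloured vertex `< n` has its colour available. -/
def Cons (n : ℕ) (col : ℕ → ℕ) (st : ℕ × ℕ × ℕ × ℕ × ℕ) : Prop :=
  ∀ w, w < n → Nat.testBit st.2.2.2.2 w = true → Nat.testBit (getC st.1 st.2.1 st.2.2.1 st.2.2.2.1 (col w)) w = true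
/-- All uncoloured vertices are `< n`. -/
def UBound (n : ℕ) (st : ℕ × ℕ × ℕ × ℕ × ℕ) : Prop :=
  ∀ v, Nat.testBit st.2.2.2.2 v = true → v < n
/-- The uncoloured set after `assign`. -/
theorem U_assign (nb : ℕ → ℕ) (C₀ C₁ C₂ C₃ U v c : ℕ) :
    (assign nb C₀ C₁ C₂ C₃ U v c).2.2.2.2 = Nat.xor U (2 ^ v) := by
  unfold assign; split_ifs <;> rfl
/-- Bool identity behind `C ∖ N` written as `C xor (C land N)`. -/
theorem bxor_band (b x : Bool) : (b ^^ (b && x)) = (b && !x) := by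
  cases b <;> cases x <;> rfl
/-- Colour words after `assign`: colour `c' ≠ c` is untouched; colour `c` loses exactly the neighbours of `v`. -/
theorem testBit_getC_assign (nb : ℕ → ℕ) (C₀ C₁ C₂ C₃ U v c c' w : ℕ) (hc : c < 4) (hc' : c' < 4) :
    Nat.testBit (getC (assign nb C₀ C₁ C₂ C₃ U v c).1 (assign nb C₀ C₁ C₂ C₃ U v c).2.1 (assign nb C₀ C₁ C₂ C₃ U v c).2.2.1
        (assign nb C₀ C₁ C₂ C₃ U v c).2.2.2.1 c') w =
      (Nat.testBit (getC C₀ C₁ C₂ C₃ c') w && !(decide (c' = c) && Nat.testBit (nb v) w)) := by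
  interval_cases c <;> interval_cases c' <;> simp [assign, getC, bxor_band]
/-- Soundness of one assignment: if `col v = c` (and `v` was uncoloured) then consistency is preserved. -/
theorem assign_cons {nb : ℕ → ℕ} {n : ℕ} {col : ℕ → ℕ} (hP : Proper nb n col) {C₀ C₁ C₂ C₃ U : ℕ}
    (hC : Cons n col (C₀, C₁, C₂, C₃, U)) (v c : ℕ) (hv : v < n) (hUv : Nat.testBit U v = true) (hcv : col v = c) :
    Cons n col (assign nb C₀ C₁ C₂ C₃ U v c) := by
  intro w hw hUw
  rw [U_assign, testBit_natXor, Nat.testBit_two_pow] at hUw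
  have hwv : w ≠ v := by
    rintro rfl; rw [hUv] at hUw; simp at hUw
  have hUw' : Nat.testBit U w = true := by
    have : decide (v = w) = false := by simpa using fun h => hwv h.symm
    rw [this] at hUw; simpa using hUw
  have hc : c < 4 := hcv ▸ (hP v hv).1
  have hcw : col w < 4 := (hP w hw).1
  rw [testBit_getC_assign nb C₀ C₁ C₂ C₃ U v c (col w) w hc hcw, hC w hw hUw']
  by_cases hnb : Nat.testBit (nb v) w = true
  · have hne : col w ≠ col v := (hP v hv).2 w hw hnb
    have : decide (col w = c) = false := by simpa using fun h => hne (h.trans hcv.symm)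
    simp [this]
  · simp [hnb]
/-- `UBound` is preserved by `assign` with `v < n`. -/
theorem uBound_assign {nb : ℕ → ℕ} {n : ℕ} {C₀ C₁ C₂ C₃ U : ℕ} (hU : UBound n (C₀, C₁, C₂, C₃, U)) (v c : ℕ) (hv : v < n) :
    UBound n (assign nb C₀ C₁ C₂ C₃ U v c) := by
  intro w hw
  rw [U_assign, testBit_natXor, Nat.testBit_two_pow] at hw
  by_cases hvw : v = w
  · exact hvw ▸ hv
  · have : decide (v = w) = false := by simpa using hvw
    rw [this] at hw; exact hU w (by simpa using hw)
/-- An uncoloured vertex with no available colour contradicts consistency. -/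
theorem false_of_dead {n : ℕ} {col : ℕ → ℕ} {C₀ C₁ C₂ C₃ U : ℕ} (hC : Cons n col (C₀, C₁, C₂, C₃, U))
    (hcol : ∀ v, v < n → col v < 4) (w : ℕ) (hw : w < n) (hU : Nat.testBit U w = true)
    (hd : deadOf (bits4 C₀ C₁ C₂ C₃ w) = true) : False := by
  have h := hC w hw hU
  have hcw := hcol w hw
  simp only at h
  cases h0 : Nat.testBit C₀ w <;> cases h1 : Nat.testBit C₁ w <;> cases h2 : Nat.testBit C₂ w <;> cases h3 : Nat.testBit C₃ w <;>
    simp only [bits4, h0, h1, h2, h3, deadOf] at hd <;> try exact Bool.false_ne_true hd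
  unfold getC at h
  interval_cases (col w) <;> simp_all
/-- Exactly one available colour forces the colour. -/
theorem forcedOf_sound {n : ℕ} {col : ℕ → ℕ} {C₀ C₁ C₂ C₃ U : ℕ} (hC : Cons n col (C₀, C₁, C₂, C₃, U))
    (hcol : ∀ v, v < n → col v < 4) (w : ℕ) (hw : w < n) (hU : Nat.testBit U w = true) {c : ℕ}
    (hf : forcedOf (bits4 C₀ C₁ C₂ C₃ w) = some c) : col w = c := by
  have h := hC w hw hU
  have hcw := hcol w hw
  simp only at h
  unfold getC at h
  cases h0 : Nat.testBit C₀ w <;> cases h1 : Nat.testBit C₁ w <;> cases h2 : Nat.testBit C₂ w <;> cases h3 : Nat.testBit C₃ w <;>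
    simp only [bits4, h0, h1, h2, h3, forcedOf, Option.some.injEq, reduceCtorEq] at hf <;> subst hf <;>
    interval_cases (col w) <;> simp_all
/-- Soundness of `forceList`. -/
theorem forceList_sound {nb : ℕ → ℕ} {n : ℕ} {col : ℕ → ℕ} (hP : Proper nb n col) :
    ∀ (f F : ℕ) (st : ℕ × ℕ × ℕ × ℕ × ℕ), UBound n st → Cons n col st →
      (forceList nb f F st = none → False) ∧
      (∀ st', forceList nb f F st = some st' → UBound n st' ∧ Cons n col st')
  | 0, F, st, hU, hC => by
      refine ⟨fun h => by simp [forceList] at h, fun st' h => ?_⟩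
      simp [forceList] at h; subst h; exact ⟨hU, hC⟩
  | f + 1, F, (C₀, C₁, C₂, C₃, U), hU, hC => by
      have hcol : ∀ v, v < n → col v < 4 := fun v hv => (hP v hv).1
      unfold forceList
      split
      · refine ⟨fun h => by simp at h, fun st' h => ?_⟩
        simp only [Option.some.injEq] at h; subst h; exact ⟨hU, hC⟩
      · split
        · rename_i hUv
          have hv : bitIdx (lowbit F) < n := hU _ hUv
          split
          · rename_i hd
            exact ⟨fun _ => false_of_dead hC hcol _ hv hUv hd, fun st' h => by simp at h⟩
          · split
            · rename_i c hf
              have hcv := forcedOf_sound hC hcol _ hv hUv hf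
              exact forceList_sound hP f _ _ (uBound_assign hU _ c hv) (assign_cons hP hC _ c hv hUv hcv)
            · exact forceList_sound hP f _ _ hU hC
        · exact forceList_sound hP f _ _ hU hC
/-- Soundness of `propagate`. -/
theorem propagate_sound {nb : ℕ → ℕ} {n : ℕ} {col : ℕ → ℕ} (hP : Proper nb n col) :
    ∀ (r : ℕ) (st : ℕ × ℕ × ℕ × ℕ × ℕ), UBound n st → Cons n col st →
      (propagate nb r st = none → False) ∧
      (∀ st', propagate nb r st = some st' → UBound n st' ∧ Cons n col st')
  | 0, st, hU, hC => by
      refine ⟨fun h => by simp [propagate] at h, fun st' h => ?_⟩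
      simp [propagate] at h; subst h; exact ⟨hU, hC⟩
  | r + 1, (C₀, C₁, C₂, C₃, U), hU, hC => by
      have hcol : ∀ v, v < n → col v < 4 := fun v hv => (hP v hv).1
      unfold propagate
      split
      · split
        · refine ⟨fun h => by simp at h, fun st' h => ?_⟩
          simp only [Option.some.injEq] at h; subst h; exact ⟨hU, hC⟩
        · have hfl := forceList_sound hP 400 (deadForced C₀ C₁ C₂ C₃ U).2 (C₀, C₁, C₂, C₃, U) hU hC
          split
          · rename_i hnone; exact ⟨fun _ => hfl.1 hnone, fun st' h => by simp at h⟩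
          · rename_i st' hst'
            obtain ⟨hU', hC'⟩ := hfl.2 st' hst'
            exact propagate_sound hP r st' hU' hC'
      · split
        · rename_i h
          simp only [Bool.and_eq_true] at h
          exact ⟨fun _ => false_of_dead hC hcol _ (hU _ h.1) h.1 h.2, fun st' h' => by simp at h'⟩
        · refine ⟨fun h => by simp at h, fun st' h => ?_⟩
          simp only [Option.some.injEq] at h; subst h; exact ⟨hU, hC⟩
/-- SOUNDNESS OF THE SEARCH: `search … st = true` excludes every proper colouring consistent with `st`, provided the same holds
for every state in `done`. -/
theorem search_sound {nb : ℕ → ℕ} {n pr : ℕ} {col : ℕ → ℕ} (hP : Proper nb n col) {done : List (ℕ × ℕ × ℕ × ℕ × ℕ)}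
    (hdone : ∀ d ∈ done, UBound n d → Cons n col d → False) :
    ∀ (f : ℕ) (st : ℕ × ℕ × ℕ × ℕ × ℕ), search nb n pr done f st = true → UBound n st → Cons n col st → False
  | 0, st, h, _, _ => by simp [search] at h
  | f + 1, (C₀, C₁, C₂, C₃, U), h, hU, hC => by
      unfold search at h
      split at h
      · rename_i hmem
        simp only [List.any_eq_true, decide_eq_true_eq] at hmem
        obtain ⟨d, hd, rfl⟩ := hmem
        exact hdone _ hd hU hC
      split at h
      · simp at h
      split at h
      · rename_i hv
        simp only [Bool.and_eq_true, decide_eq_true_eq] at hv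
        obtain ⟨hvn, hUv⟩ := hv
        generalize hvdef : branchVertex nb C₀ C₁ C₂ C₃ U = v at hvn hUv h
        have hcv : col v < 4 := (hP v hvn).1
        have hbit : Nat.testBit (getC C₀ C₁ C₂ C₃ (col v)) v = true := hC v hvn hUv
        simp only [List.all_cons, List.all_nil, Bool.and_true, Bool.and_eq_true] at h
        have key : ∀ c, col v = c →
            (!Nat.testBit (getC C₀ C₁ C₂ C₃ c) v ||
              (match propagate nb pr (assign nb C₀ C₁ C₂ C₃ U v c) with
               | none => true
               | some st' => search nb n pr done f st')) = true → False := by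
          intro c hc hb
          rw [← hc, Bool.or_eq_true] at hb
          rcases hb with hb | hb
          · simp [hbit] at hb
          · obtain ⟨hnone, hsome⟩ :=
              propagate_sound hP pr _ (uBound_assign hU v (col v) hvn) (assign_cons hP hC v (col v) hvn hUv rfl)
            split at hb
            · rename_i heq; exact hnone heq
            · rename_i st' heq
              obtain ⟨hU'', hC''⟩ := hsome st' heq
              exact search_sound hP hdone f st' hb hU'' hC''
        obtain ⟨h0, h1, h2, h3⟩ := h
        interval_cases hcol : col v
        · exact key 0 rfl h0
        · exact key 1 rfl h1
        · exact key 2 rfl h2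
        · exact key 3 rfl h3
      · simp at h

/-! ## Iterative driver (explicit stack; kernel recursion depth = number of processed nodes) -/

/-- Children of a state: for every colour still available at the branching vertex `v`, the assigned-and-propagated state
(dead children are dropped). -/
def children (nb : ℕ → ℕ) (pr : ℕ) (C₀ C₁ C₂ C₃ U v : ℕ) : List (ℕ × ℕ × ℕ × ℕ × ℕ) :=
  [0, 1, 2, 3].filterMap fun c =>
    if Nat.testBit (getC C₀ C₁ C₂ C₃ c) v then propagate nb pr (assign nb C₀ C₁ C₂ C₃ U v c) else none
/-- THE SEARCH, iterative form: process a stack of pending states one node per step (`f` steps); `true` iff every pending state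
was refuted (dies, or is in `done`) within the budget. -/
def runSearch (nb : ℕ → ℕ) (n pr : ℕ) (done : List (ℕ × ℕ × ℕ × ℕ × ℕ)) : ℕ → List (ℕ × ℕ × ℕ × ℕ × ℕ) → Bool
  | 0, stack => stack.isEmpty
  | _ + 1, [] => true
  | f + 1, (C₀, C₁, C₂, C₃, U) :: rest =>
      if done.any fun d => decide (d = (C₀, C₁, C₂, C₃, U)) then runSearch nb n pr done f rest
      else if U = 0 then false
      else
        if branchVertex nb C₀ C₁ C₂ C₃ U < n && Nat.testBit U (branchVertex nb C₀ C₁ C₂ C₃ U) then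
          runSearch nb n pr done f (children nb pr C₀ C₁ C₂ C₃ U (branchVertex nb C₀ C₁ C₂ C₃ U) ++ rest)
        else false
/-- SOUNDNESS OF THE ITERATIVE SEARCH: if `runSearch … stack = true` then no state on the stack admits a consistent proper colouring
(given the same for the states in `done`). -/
theorem runSearch_sound {nb : ℕ → ℕ} {n pr : ℕ} {col : ℕ → ℕ} (hP : Proper nb n col) {done : List (ℕ × ℕ × ℕ × ℕ × ℕ)}
    (hdone : ∀ d ∈ done, UBound n d → Cons n col d → False) :
    ∀ (f : ℕ) (stack : List (ℕ × ℕ × ℕ × ℕ × ℕ)), runSearch nb n pr done f stack = true →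
      ∀ st ∈ stack, UBound n st → Cons n col st → False
  | 0, stack, h, st, hst, _, _ => by
      simp only [runSearch, List.isEmpty_iff] at h
      simp [h] at hst
  | f + 1, [], _, st, hst, _, _ => by simp at hst
  | f + 1, (C₀, C₁, C₂, C₃, U) :: rest, h, st, hst, hU, hC => by
      unfold runSearch at h
      -- first establish the claim for the tail under either branch, then for the head
      split at h
      · rename_i hmem
        simp only [List.any_eq_true, decide_eq_true_eq] at hmem
        obtain ⟨d, hd, hdeq⟩ := hmem
        rcases List.mem_cons.1 hst with rfl | htail
        · exact hdone d hd (hdeq ▸ hU) (hdeq ▸ hC)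
        · exact runSearch_sound hP hdone f rest h st htail hU hC
      split at h
      · simp at h
      split at h
      · rename_i hv
        simp only [Bool.and_eq_true, decide_eq_true_eq] at hv
        obtain ⟨hvn, hUv⟩ := hv
        have htail : ∀ st' ∈ children nb pr C₀ C₁ C₂ C₃ U (branchVertex nb C₀ C₁ C₂ C₃ U) ++ rest,
            UBound n st' → Cons n col st' → False := fun st' hst' => runSearch_sound hP hdone f _ h st' hst'
        rcases List.mem_cons.1 hst with rfl | hrest
        · -- the head state: its child along `col v` is on the new stack (or died)
          generalize hvdef : branchVertex nb C₀ C₁ C₂ C₃ U = v at hvn hUv htail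
          have hcv : col v < 4 := (hP v hvn).1
          have hbit : Nat.testBit (getC C₀ C₁ C₂ C₃ (col v)) v = true := hC v hvn hUv
          obtain ⟨hnone, hsome⟩ :=
            propagate_sound hP pr _ (uBound_assign hU v (col v) hvn) (assign_cons hP hC v (col v) hvn hUv rfl)
          cases hprop : propagate nb pr (assign nb C₀ C₁ C₂ C₃ U v (col v)) with
          | none => exact hnone hprop
          | some st' =>
              obtain ⟨hU', hC'⟩ := hsome st' hprop
              refine htail st' (List.mem_append.2 (Or.inl ?_)) hU' hC'
              simp only [children, List.mem_filterMap]
              refine ⟨col v, ?_, ?_⟩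
              · have : col v = 0 ∨ col v = 1 ∨ col v = 2 ∨ col v = 3 := by omega
                rcases this with h | h | h | h <;> simp [h]
              · simp [hbit, hprop]
        · exact htail st (List.mem_append.2 (Or.inr hrest)) hU hC
      · simp at h

end Summit.Ventures.DiscreteObjects.UnitDistance.KBits
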